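import Summits.BirchSwinnertonDyer.BirchSwinnertonDyer.Theorems.ManinLocalTwoThreeCuspToolkitTwentySeven
import Summits.BirchSwinnertonDyer.BirchSwinnertonDyer.Theorems.ManinLocalTwoThreeAnalyticBridge
import HarnessLib

/-!
# Reduction of Ligozat's `η`-identities at level 27 to three `q`-asymptotics at `i∞`

Cell bsd-f2-manin, route `ManinLocalTwoThree`, the analytic debt (S2) of the hexagonal squeeze
(`HexagonalSqueezeTwentySeven`, `AnalyticBridge.periodLatticeLeHex_of_etaIdentities`).

THE CUSP-FORM ARGUMENT (`deriv_eq_of_tendsto`).  Let `x, y : ℍ → ℂ` be holomorphic and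
`Γ₀(27)`-invariant, with `x ∘ γ` and `y ∘ γ` bounded at `i∞` for every `γ ∈ SL₂(ℤ) ∖ Γ₀(27)`, and put
`R = (2πi)⁻¹ x′ + φ₂₇ · y` (weight `2`).  If `R(τ)/q → 0` at `i∞` then `R ≡ 0`, i.e. `x′ = −2πi φ₂₇ y`:
`R` is a weight-`2` cusp form on `Γ₀(27)` (at the cusps off `∞`, `(x∘γ)′ → 0` by Cauchy's estimate
and `φ₂₇|γ → 0`; at `∞` by hypothesis), `S₂(Γ₀(27)) = ℂφ₂₇` and `φ₂₇/q → 1`.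

THE REDUCTION (`periodLatticeLeHex_of_tendsto`, `abs_maninConstant_eq_one_twentySeven_of_tendsto`).
With `x = η(9τ)⁴/(η(3τ)η(27τ)³)`, `u = η(3τ)³/η(27τ)³` (bounded at every cusp off `∞`: Ligozat orders
`0, 0, 648` and `24, 216, 0` at `gcd(c, 27) = 1, 3, 9`), (S2) — hence `|c| = 1` for every `X₀(27)`-datum
with the lattice clause — follows from THREE LIMITS at `i∞`:
(T1) `((2πi)⁻¹x′ + φ₂₇(2u + 9))/q → 0`, (T2) `((2πi)⁻¹u′ + 3φ₂₇x²)/q → 0`, (T3) `x³ − u² − 9u − 27 → 0`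
((T1), (T2) give `x′ = −2πiφ₂₇(2u+9)`, `u′ = −6πiφ₂₇x²`, so `x³ − u² − 9u − 27` has zero derivative, is
constant on `ℍ`, and vanishes by (T3)).  These are statements about the first `q`-expansion
coefficients of `η`-products (`E₃ ≡ 1 − q³ − q⁶`, `E₉ ≡ E₂₇ ≡ 1 (mod q⁹)`), not proved here.
-/

set_option autoImplicit false
set_option linter.dupNamespace false

noncomputable section

open Complex Filter Topology Set Function Asymptotics
open UpperHalfPlane hiding I
open scoped Real Topology Manifold MatrixGroups ModularForm
open ModularForm CongruenceSubgroup
open Literature.NumberTheory.EllipticCurves Literature.NumberTheory.EllipticCurves.ModularForms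

namespace Summit.BirchSwinnertonDyer.BirchSwinnertonDyer.Theorems.ManinLocalTwoThree.EtaIdentityReduction

open CuspToolkit AnalyticBridge

/-! ## 1. The weight-2 combination `R = (2πi)⁻¹ x′ + φ₂₇ y` under `SL₂(ℤ)` -/

/-- `(R|₂A)(τ) = (2πi)⁻¹ (x∘A)′(τ) + (φ₂₇|₂A)(τ) · y(Aτ)`. [folklore] -/
theorem slash_two_apply {x : ℍ → ℂ} (y : ℍ → ℂ) (hx : MDifferentiable 𝓘(ℂ) 𝓘(ℂ) x) (A : SL(2, ℤ))
    (τ : ℍ) :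
    ((fun σ : ℍ ↦ (2 * π * I)⁻¹ * deriv (x ∘ ofComplex) σ + cuspFormEtaProductTwentySeven σ * y σ)
        ∣[(2 : ℤ)] A) τ
      = (2 * π * I)⁻¹ * deriv ((fun σ : ℍ ↦ x (A • σ)) ∘ ofComplex) τ
        + (⇑cuspFormEtaProductTwentySeven ∣[(2 : ℤ)] A) τ * y (A • τ) := by
  rw [SL_slash_apply, SL_slash_apply, ModularGroup.denom_apply, deriv_comp_smul_ofComplex hx A τ]
  have hJ : ((A 1 0 : ℤ) : ℂ) * (τ : ℂ) + ((A 1 1 : ℤ) : ℂ) ≠ 0 := SL2_denom_ne_zero A τ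
  rw [zpow_neg, zpow_ofNat]
  field_simp

/-- `R/q → 0` at `i∞` implies `R → 0` at `i∞` (`|q| < 1`). [folklore] -/
theorem isZeroAtImInfty_of_tendsto_div_qParam {R : ℍ → ℂ}
    (h : Tendsto (fun τ : ℍ ↦ R τ / Function.Periodic.qParam 1 (τ : ℂ)) atImInfty (𝓝 0)) :
    IsZeroAtImInfty R := by
  have hq : IsBoundedUnder (· ≤ ·) atImInfty
      ((‖·‖) ∘ fun τ : ℍ ↦ Function.Periodic.qParam 1 (τ : ℂ)) :=
    ⟨1, Filter.eventually_map.mpr (Filter.Eventually.of_forall fun τ ↦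
      (Function.Periodic.norm_qParam_lt_one one_pos τ.im_pos).le)⟩
  have := h.zero_mul_isBoundedUnder_le hq
  refine this.congr fun τ ↦ ?_
  exact div_mul_cancel₀ _ (by simp [Function.Periodic.qParam, Complex.exp_ne_zero])

/-- The weight-`2` combination `R = (2πi)⁻¹x′ + φ₂₇y` IS A CUSP FORM on `Γ₀(27)` when `x, y` are
holomorphic and `Γ₀(27)`-invariant, `x∘γ`, `y∘γ` are bounded at `i∞` off `Γ₀(27)`, and `R → 0` at `i∞`.
[folklore] -/
theorem exists_cuspForm (x y : ℍ → ℂ) (hx : MDifferentiable 𝓘(ℂ) 𝓘(ℂ) x)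
    (hy : MDifferentiable 𝓘(ℂ) 𝓘(ℂ) y)
    (hxinv : ∀ γ : SL(2, ℤ), γ ∈ Gamma0 27 → ∀ τ : ℍ, x (γ • τ) = x τ)
    (hyinv : ∀ γ : SL(2, ℤ), γ ∈ Gamma0 27 → ∀ τ : ℍ, y (γ • τ) = y τ)
    (hxb : ∀ γ : SL(2, ℤ), γ ∉ Gamma0 27 → IsBoundedAtImInfty (fun τ : ℍ ↦ x (γ • τ)))
    (hyb : ∀ γ : SL(2, ℤ), γ ∉ Gamma0 27 → IsBoundedAtImInfty (fun τ : ℍ ↦ y (γ • τ)))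
    (h0 : IsZeroAtImInfty
      (fun σ : ℍ ↦ (2 * π * I)⁻¹ * deriv (x ∘ ofComplex) σ + cuspFormEtaProductTwentySeven σ * y σ)) :
    ∃ S : CuspForm (Gamma0 27) 2, ∀ τ : ℍ,
      S τ = (2 * π * I)⁻¹ * deriv (x ∘ ofComplex) τ + cuspFormEtaProductTwentySeven τ * y τ := by
  have hdiffx := UpperHalfPlane.mdifferentiable_iff.mp hx
  have hφinv : ∀ γ : SL(2, ℤ), γ ∈ Gamma0 27 →
      (⇑cuspFormEtaProductTwentySeven ∣[(2 : ℤ)] γ) = ⇑cuspFormEtaProductTwentySeven := fun γ hγ ↦ by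
    have h := SlashInvariantForm.slash_action_eqn cuspFormEtaProductTwentySeven _ ⟨γ, hγ, rfl⟩
    rw [SL_slash]
    exact h
  refine ⟨{ toFun := fun σ : ℍ ↦ (2 * π * I)⁻¹ * deriv (x ∘ ofComplex) σ
              + cuspFormEtaProductTwentySeven σ * y σ
            slash_action_eq' := ?_
            holo' := ?_
            zero_at_cusps' := ?_ }, fun τ ↦ rfl⟩
  · -- invariance under `Γ₀(27)`
    intro A hA
    obtain ⟨γ, hγ, rfl⟩ := hA
    funext τ
    show ((fun σ : ℍ ↦ (2 * π * I)⁻¹ * deriv (x ∘ ofComplex) σ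
      + cuspFormEtaProductTwentySeven σ * y σ) ∣[(2 : ℤ)] γ) τ = _
    rw [slash_two_apply y hx γ τ, hφinv γ hγ, hyinv γ hγ τ,
      show (fun σ : ℍ ↦ x (γ • σ)) = x from funext (hxinv γ hγ)]
  · -- holomorphy
    rw [UpperHalfPlane.mdifferentiable_iff]
    have hD : DifferentiableOn ℂ (deriv (x ∘ ofComplex)) {z : ℂ | 0 < z.im} :=
      (hdiffx.analyticOnNhd isOpen_upperHalfPlaneSet).deriv.differentiableOn
    have hφ := UpperHalfPlane.mdifferentiable_iff.mp (CuspFormClass.holo cuspFormEtaProductTwentySeven)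
    have hy' := UpperHalfPlane.mdifferentiable_iff.mp hy
    have h : DifferentiableOn ℂ (fun z : ℂ ↦ (2 * π * I)⁻¹ * deriv (x ∘ ofComplex) z
        + (cuspFormEtaProductTwentySeven ∘ ofComplex) z * (y ∘ ofComplex) z) {z : ℂ | 0 < z.im} :=
      (hD.const_mul _).add (hφ.mul hy')
    refine h.congr fun z hz ↦ ?_
    simp only [Function.comp_apply, ofComplex_apply_of_im_pos hz]
    rfl
  · -- vanishing at all cusps
    intro c hc
    rw [Subgroup.IsArithmetic.isCusp_iff_isCusp_SL2Z] at hc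
    rw [OnePoint.isZeroAt_iff_forall_SL2Z hc]
    intro A _
    show IsZeroAtImInfty ((fun σ : ℍ ↦ (2 * π * I)⁻¹ * deriv (x ∘ ofComplex) σ
      + cuspFormEtaProductTwentySeven σ * y σ) ∣[(2 : ℤ)] A)
    have hfun : ((fun σ : ℍ ↦ (2 * π * I)⁻¹ * deriv (x ∘ ofComplex) σ
        + cuspFormEtaProductTwentySeven σ * y σ) ∣[(2 : ℤ)] A)
        = fun τ : ℍ ↦ (2 * π * I)⁻¹ * deriv ((fun σ : ℍ ↦ x (A • σ)) ∘ ofComplex) τ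
          + (⇑cuspFormEtaProductTwentySeven ∣[(2 : ℤ)] A) τ * y (A • τ) :=
      funext (slash_two_apply y hx A)
    rw [hfun]
    by_cases hA : A ∈ Gamma0 27
    · have hxA : (fun σ : ℍ ↦ x (A • σ)) = x := funext (hxinv A hA)
      simp_rw [hxA, hφinv A hA, hyinv A hA]
      exact h0
    · have h1 : IsZeroAtImInfty (fun τ : ℍ ↦ deriv ((fun σ : ℍ ↦ x (A • σ)) ∘ ofComplex) τ) :=
        isZeroAtImInfty_deriv_of_isBoundedAtImInfty (CuspToolkit.mdifferentiable_comp_smul hx A) (hxb A hA)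
      have h2 : IsZeroAtImInfty (⇑cuspFormEtaProductTwentySeven ∣[(2 : ℤ)] A) :=
        CuspFormClass.zero_at_infty_slash cuspFormEtaProductTwentySeven A
      have h3 : IsZeroAtImInfty
          (fun τ : ℍ ↦ (⇑cuspFormEtaProductTwentySeven ∣[(2 : ℤ)] A) τ * y (A • τ)) :=
        h2.mul_boundedAtFilter (hyb A hA)
      have h4 : IsZeroAtImInfty
          (fun τ : ℍ ↦ (2 * π * I)⁻¹ * deriv ((fun σ : ℍ ↦ x (A • σ)) ∘ ofComplex) τ) :=
        (const_boundedAtFilter atImInfty ((2 * π * I)⁻¹ : ℂ)).mul_zeroAtFilter h1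
      exact h4.add h3

/-- **The cusp-form argument.**  With `x, y` as in `exists_cuspForm`: if
`((2πi)⁻¹x′ + φ₂₇y)/q → 0` at `i∞`, then `x′ = −2πi φ₂₇ y` on `ℍ`. [folklore] -/
theorem deriv_eq_of_tendsto (x y : ℍ → ℂ) (hx : MDifferentiable 𝓘(ℂ) 𝓘(ℂ) x)
    (hy : MDifferentiable 𝓘(ℂ) 𝓘(ℂ) y)
    (hxinv : ∀ γ : SL(2, ℤ), γ ∈ Gamma0 27 → ∀ τ : ℍ, x (γ • τ) = x τ)
    (hyinv : ∀ γ : SL(2, ℤ), γ ∈ Gamma0 27 → ∀ τ : ℍ, y (γ • τ) = y τ)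
    (hxb : ∀ γ : SL(2, ℤ), γ ∉ Gamma0 27 → IsBoundedAtImInfty (fun τ : ℍ ↦ x (γ • τ)))
    (hyb : ∀ γ : SL(2, ℤ), γ ∉ Gamma0 27 → IsBoundedAtImInfty (fun τ : ℍ ↦ y (γ • τ)))
    (hlim : Tendsto (fun τ : ℍ ↦ ((2 * π * I)⁻¹ * deriv (x ∘ ofComplex) τ
      + cuspFormEtaProductTwentySeven τ * y τ) / Function.Periodic.qParam 1 (τ : ℂ)) atImInfty (𝓝 0)) :
    ∀ τ : ℍ, deriv (x ∘ ofComplex) τ = -(2 * π * I * cuspFormEtaProductTwentySeven τ) * y τ := by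
  obtain ⟨S, hS⟩ := exists_cuspForm x y hx hy hxinv hyinv hxb hyb
    (isZeroAtImInfty_of_tendsto_div_qParam hlim)
  have hS0 : S = 0 := by
    refine cuspForm_twentySeven_eq_zero_of_tendsto S (hlim.congr fun τ ↦ ?_)
    rw [hS τ]
  intro τ
  have h := hS τ
  rw [hS0, CuspForm.zero_apply] at h
  have h2pi : (2 * π * I : ℂ) ≠ 0 := by simp [Real.pi_ne_zero, I_ne_zero]
  have h' : deriv (x ∘ ofComplex) τ
      = (2 * π * I) * ((2 * π * I)⁻¹ * deriv (x ∘ ofComplex) τ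
        + cuspFormEtaProductTwentySeven τ * y τ) - 2 * π * I * cuspFormEtaProductTwentySeven τ * y τ := by
    field_simp
    ring
  rw [h', ← h]
  ring

/-! ## 2. Ligozat's functions `x`, `u` are bounded at every cusp off `∞` -/

/-- Ligozat's order is non-negative at every `c` with `27 ∤ c`, given the three values at
`gcd(c, 27) ∈ {1, 3, 9}`. [folklore] -/
theorem cuspOrder24_nonneg_of_not_dvd (r : ℕ → ℤ) (h1 : 0 ≤ cuspOrder24 27 r 1)
    (h3 : 0 ≤ cuspOrder24 27 r 3) (h9 : 0 ≤ cuspOrder24 27 r 9) {c : ℤ} (hc : ¬ (27 : ℤ) ∣ c) :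
    0 ≤ cuspOrder24 27 r c := by
  rw [cuspOrder24_eq_gcd]
  have hdvd : Nat.gcd 27 c.natAbs ∣ 27 := Nat.gcd_dvd_left _ _
  have hne : Nat.gcd 27 c.natAbs ≠ 27 := by
    intro h
    apply hc
    have h27 : (27 : ℕ) ∣ c.natAbs := h ▸ Nat.gcd_dvd_right _ _
    exact Int.natCast_dvd.mpr h27
  have hmem : Nat.gcd 27 c.natAbs ∈ Nat.divisors 27 := Nat.mem_divisors.mpr ⟨hdvd, by norm_num⟩
  rw [show Nat.divisors 27 = {1, 3, 9, 27} by decide] at hmem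
  simp only [Finset.mem_insert, Finset.mem_singleton] at hmem
  rcases hmem with h | h | h | h
  · rw [h]; exact_mod_cast h1
  · rw [h]; exact_mod_cast h3
  · rw [h]; exact_mod_cast h9
  · exact absurd h hne

/-- `γ ∉ Γ₀(27)` iff `27 ∤ c`. [folklore] -/
theorem not_dvd_of_not_mem {γ : SL(2, ℤ)} (hγ : γ ∉ Gamma0 27) : ¬ (27 : ℤ) ∣ γ 1 0 := by
  intro h
  apply hγ
  rw [Gamma0_mem]
  exact (ZMod.intCast_zmod_eq_zero_iff_dvd _ 27).mpr h

/-- `x ∘ γ` is bounded at `i∞` for `γ ∉ Γ₀(27)` (Ligozat orders `0, 0, 648`). [folklore] -/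
theorem isBoundedAtImInfty_ligozatX_smul {γ : SL(2, ℤ)} (hγ : γ ∉ Gamma0 27) :
    IsBoundedAtImInfty (fun τ : ℍ ↦ etaQuotient 27 (expFn [(3, -1), (9, 4), (27, -3)]) (γ • τ)) :=
  isBoundedAtImInfty_etaQuotient_smul 27 (by norm_num) _ (by decide) γ
    (cuspOrder24_nonneg_of_not_dvd _ (by decide) (by decide) (by decide) (not_dvd_of_not_mem hγ))

/-- `u ∘ γ` is bounded at `i∞` for `γ ∉ Γ₀(27)` (Ligozat orders `24, 216, 0`). [folklore] -/
theorem isBoundedAtImInfty_ligozatU_smul {γ : SL(2, ℤ)} (hγ : γ ∉ Gamma0 27) :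
    IsBoundedAtImInfty (fun τ : ℍ ↦ etaQuotient 27 (expFn [(3, 3), (27, -3)]) (γ • τ)) :=
  isBoundedAtImInfty_etaQuotient_smul 27 (by norm_num) _ (by decide) γ
    (cuspOrder24_nonneg_of_not_dvd _ (by decide) (by decide) (by decide) (not_dvd_of_not_mem hγ))

/-! ## 3. The three limits at `i∞` imply Ligozat's identities, (S2) and `|c| = 1` -/

/-- **(I2a) from (T1)**: `x′ = −2πi φ₂₇ (2u + 9)`. [folklore] -/
theorem ligozat_deriv_x_of_tendsto
    (hT1 : Tendsto (fun τ : ℍ ↦ ((2 * π * I)⁻¹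
      * deriv (etaQuotient 27 (expFn [(3, -1), (9, 4), (27, -3)]) ∘ ofComplex) τ
      + cuspFormEtaProductTwentySeven τ * (2 * etaQuotient 27 (expFn [(3, 3), (27, -3)]) τ + 9))
      / Function.Periodic.qParam 1 (τ : ℂ)) atImInfty (𝓝 0)) :
    ∀ τ : ℍ, deriv (etaQuotient 27 (expFn [(3, -1), (9, 4), (27, -3)]) ∘ ofComplex) τ
      = -(2 * π * I * cuspFormEtaProductTwentySeven τ)
          * (2 * etaQuotient 27 (expFn [(3, 3), (27, -3)]) τ + 9) := by
  refine deriv_eq_of_tendsto _ (fun τ ↦ 2 * etaQuotient 27 (expFn [(3, 3), (27, -3)]) τ + 9)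
    (mdifferentiable_etaQuotient 27 _) ?_ (fun γ hγ τ ↦ ligozatX_smul ⟨γ, hγ⟩ τ)
    (fun γ hγ τ ↦ by simp only [ligozatU_smul ⟨γ, hγ⟩ τ])
    (fun γ hγ ↦ isBoundedAtImInfty_ligozatX_smul hγ) (fun γ hγ ↦ ?_) hT1
  · exact ((mdifferentiable_etaQuotient 27 _).const_smul (2 : ℂ)).add mdifferentiable_const
  · exact ((isBoundedAtImInfty_ligozatU_smul hγ).const_mul_left 2).add
      (const_boundedAtFilter atImInfty (9 : ℂ))

/-- **(I2b) from (T2)**: `u′ = −2πi φ₂₇ · 3x²`. [folklore] -/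
theorem ligozat_deriv_u_of_tendsto
    (hT2 : Tendsto (fun τ : ℍ ↦ ((2 * π * I)⁻¹
      * deriv (etaQuotient 27 (expFn [(3, 3), (27, -3)]) ∘ ofComplex) τ
      + cuspFormEtaProductTwentySeven τ * (3 * etaQuotient 27 (expFn [(3, -1), (9, 4), (27, -3)]) τ ^ 2))
      / Function.Periodic.qParam 1 (τ : ℂ)) atImInfty (𝓝 0)) :
    ∀ τ : ℍ, deriv (etaQuotient 27 (expFn [(3, 3), (27, -3)]) ∘ ofComplex) τ
      = -(2 * π * I * cuspFormEtaProductTwentySeven τ)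
          * (3 * etaQuotient 27 (expFn [(3, -1), (9, 4), (27, -3)]) τ ^ 2) := by
  refine deriv_eq_of_tendsto _ (fun τ ↦ 3 * etaQuotient 27 (expFn [(3, -1), (9, 4), (27, -3)]) τ ^ 2)
    (mdifferentiable_etaQuotient 27 _) ?_ (fun γ hγ τ ↦ ligozatU_smul ⟨γ, hγ⟩ τ)
    (fun γ hγ τ ↦ by simp only [ligozatX_smul ⟨γ, hγ⟩ τ])
    (fun γ hγ ↦ isBoundedAtImInfty_ligozatU_smul hγ) (fun γ hγ ↦ ?_) hT2
  · exact ((mdifferentiable_etaQuotient 27 _).pow 2).const_smul (3 : ℂ)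
  · exact ((isBoundedAtImInfty_ligozatX_smul hγ).mul (isBoundedAtImInfty_ligozatX_smul hγ)
      |>.const_mul_left 3).congr_left fun τ ↦ by simp only [Pi.mul_apply]; ring

/-- **(I1) from (I2a), (I2b), (T3)**: `x³ = u² + 9u + 27` — the derivative of `x³ − u² − 9u − 27`
vanishes identically, so it is constant on `ℍ`, and it tends to `0` at `i∞`. [folklore] -/
theorem ligozat_cubic_of_deriv
    (hx : ∀ τ : ℍ, deriv (etaQuotient 27 (expFn [(3, -1), (9, 4), (27, -3)]) ∘ ofComplex) τ
      = -(2 * π * I * cuspFormEtaProductTwentySeven τ)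
          * (2 * etaQuotient 27 (expFn [(3, 3), (27, -3)]) τ + 9))
    (hu : ∀ τ : ℍ, deriv (etaQuotient 27 (expFn [(3, 3), (27, -3)]) ∘ ofComplex) τ
      = -(2 * π * I * cuspFormEtaProductTwentySeven τ)
          * (3 * etaQuotient 27 (expFn [(3, -1), (9, 4), (27, -3)]) τ ^ 2))
    (hT3 : Tendsto (fun τ : ℍ ↦ etaQuotient 27 (expFn [(3, -1), (9, 4), (27, -3)]) τ ^ 3
      - etaQuotient 27 (expFn [(3, 3), (27, -3)]) τ ^ 2
      - 9 * etaQuotient 27 (expFn [(3, 3), (27, -3)]) τ - 27) atImInfty (𝓝 0)) :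
    ∀ τ : ℍ, etaQuotient 27 (expFn [(3, -1), (9, 4), (27, -3)]) τ ^ 3
      = etaQuotient 27 (expFn [(3, 3), (27, -3)]) τ ^ 2
        + 9 * etaQuotient 27 (expFn [(3, 3), (27, -3)]) τ + 27 := by
  set X : ℍ → ℂ := etaQuotient 27 (expFn [(3, -1), (9, 4), (27, -3)]) with hX
  set U : ℍ → ℂ := etaQuotient 27 (expFn [(3, 3), (27, -3)]) with hU
  have hXd := UpperHalfPlane.mdifferentiable_iff.mp (mdifferentiable_etaQuotient 27
    (expFn [(3, -1), (9, 4), (27, -3)]))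
  have hUd := UpperHalfPlane.mdifferentiable_iff.mp (mdifferentiable_etaQuotient 27
    (expFn [(3, 3), (27, -3)]))
  -- `P′ = 0` on the half-plane, `P(z) = x³ − u² − 9u − 27`
  have hderiv : ∀ z ∈ {z : ℂ | 0 < z.im}, deriv (fun z : ℂ ↦ (X ∘ ofComplex) z ^ 3
      - (U ∘ ofComplex) z ^ 2 - 9 * (U ∘ ofComplex) z - 27) z = 0 := by
    intro z hz
    have h1 : HasDerivAt (X ∘ ofComplex) (deriv (X ∘ ofComplex) z) z :=
      ((hXd z hz).differentiableAt (isOpen_upperHalfPlaneSet.mem_nhds hz)).hasDerivAt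
    have h2 : HasDerivAt (U ∘ ofComplex) (deriv (U ∘ ofComplex) z) z :=
      ((hUd z hz).differentiableAt (isOpen_upperHalfPlaneSet.mem_nhds hz)).hasDerivAt
    have hPd := (((h1.pow 3).sub (h2.pow 2)).sub (h2.const_mul 9)).sub_const (27 : ℂ)
    have hfun : (fun z : ℂ ↦ (X ∘ ofComplex) z ^ 3 - (U ∘ ofComplex) z ^ 2
        - 9 * (U ∘ ofComplex) z - 27)
        = fun x ↦ (X ∘ ofComplex ^ 3 - U ∘ ofComplex ^ 2 - fun y ↦ 9 * (U ∘ ofComplex) y) x - 27 := by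
      funext w
      simp only [Pi.sub_apply, Pi.pow_apply]
    rw [hfun, hPd.deriv]
    have hx' := hx ⟨z, hz⟩
    have hu' := hu ⟨z, hz⟩
    have hcoe : ((⟨z, hz⟩ : ℍ) : ℂ) = z := rfl
    rw [hcoe] at hx' hu'
    simp only [Function.comp_apply, ofComplex_apply_of_im_pos hz]
    rw [hx', hu', show (3 : ℕ) - 1 = 2 from rfl, show (2 : ℕ) - 1 = 1 from rfl]
    push_cast
    ring
  -- hence `P` is constant on the half-plane
  have hPdiff : DifferentiableOn ℂ (fun z : ℂ ↦ (X ∘ ofComplex) z ^ 3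
      - (U ∘ ofComplex) z ^ 2 - 9 * (U ∘ ofComplex) z - 27) {z : ℂ | 0 < z.im} :=
    (((hXd.pow 3).sub (hUd.pow 2)).sub (hUd.const_mul 9)).sub_const 27
  have hconst : ∀ z ∈ {z : ℂ | 0 < z.im}, ∀ w ∈ {z : ℂ | 0 < z.im},
      (fun z : ℂ ↦ (X ∘ ofComplex) z ^ 3 - (U ∘ ofComplex) z ^ 2 - 9 * (U ∘ ofComplex) z - 27) z
        = (fun z : ℂ ↦ (X ∘ ofComplex) z ^ 3 - (U ∘ ofComplex) z ^ 2 - 9 * (U ∘ ofComplex) z - 27) w :=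
    fun z hz w hw ↦ isOpen_upperHalfPlaneSet.is_const_of_deriv_eq_zero
      convex_setOf_im_pos.isPreconnected hPdiff hderiv hz hw
  -- and its value is the limit `0`
  intro τ
  have hlim : Tendsto (fun σ : ℍ ↦ X σ ^ 3 - U σ ^ 2 - 9 * U σ - 27) atImInfty
      (𝓝 (X τ ^ 3 - U τ ^ 2 - 9 * U τ - 27)) := by
    refine tendsto_const_nhds.congr fun σ ↦ ?_
    have h := hconst _ τ.im_pos _ σ.im_pos
    simp only [Function.comp_apply, ofComplex_apply] at h
    exact h
  have h0 : X τ ^ 3 - U τ ^ 2 - 9 * U τ - 27 = 0 := tendsto_nhds_unique hlim hT3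
  linear_combination h0

/-- **(S2) from the three limits (T1)–(T3).** [folklore] -/
theorem periodLatticeLeHex_of_tendsto
    (hT1 : Tendsto (fun τ : ℍ ↦ ((2 * π * I)⁻¹
      * deriv (etaQuotient 27 (expFn [(3, -1), (9, 4), (27, -3)]) ∘ ofComplex) τ
      + cuspFormEtaProductTwentySeven τ * (2 * etaQuotient 27 (expFn [(3, 3), (27, -3)]) τ + 9))
      / Function.Periodic.qParam 1 (τ : ℂ)) atImInfty (𝓝 0))
    (hT2 : Tendsto (fun τ : ℍ ↦ ((2 * π * I)⁻¹
      * deriv (etaQuotient 27 (expFn [(3, 3), (27, -3)]) ∘ ofComplex) τ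
      + cuspFormEtaProductTwentySeven τ * (3 * etaQuotient 27 (expFn [(3, -1), (9, 4), (27, -3)]) τ ^ 2))
      / Function.Periodic.qParam 1 (τ : ℂ)) atImInfty (𝓝 0))
    (hT3 : Tendsto (fun τ : ℍ ↦ etaQuotient 27 (expFn [(3, -1), (9, 4), (27, -3)]) τ ^ 3
      - etaQuotient 27 (expFn [(3, 3), (27, -3)]) τ ^ 2
      - 9 * etaQuotient 27 (expFn [(3, 3), (27, -3)]) τ - 27) atImInfty (𝓝 0)) :
    ∃ L₁ : PeriodPair, L₁.g₂ = 0 ∧ L₁.g₃ = 27 ∧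
      ∀ z ∈ periodLattice cuspFormEtaProductTwentySeven, z ∈ L₁.lattice :=
  periodLatticeLeHex_of_etaIdentities
    (ligozat_cubic_of_deriv (ligozat_deriv_x_of_tendsto hT1) (ligozat_deriv_u_of_tendsto hT2) hT3)
    (ligozat_deriv_x_of_tendsto hT1)

/-- **`|c| = 1` on `X₀(27)` from the three limits (T1)–(T3)**: for every globally minimal `W/ℚ` and every
`X₀(27)`-datum with the lattice clause. [folklore] -/
theorem abs_maninConstant_eq_one_twentySeven_of_tendsto
    (hT1 : Tendsto (fun τ : ℍ ↦ ((2 * π * I)⁻¹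
      * deriv (etaQuotient 27 (expFn [(3, -1), (9, 4), (27, -3)]) ∘ ofComplex) τ
      + cuspFormEtaProductTwentySeven τ * (2 * etaQuotient 27 (expFn [(3, 3), (27, -3)]) τ + 9))
      / Function.Periodic.qParam 1 (τ : ℂ)) atImInfty (𝓝 0))
    (hT2 : Tendsto (fun τ : ℍ ↦ ((2 * π * I)⁻¹
      * deriv (etaQuotient 27 (expFn [(3, 3), (27, -3)]) ∘ ofComplex) τ
      + cuspFormEtaProductTwentySeven τ * (3 * etaQuotient 27 (expFn [(3, -1), (9, 4), (27, -3)]) τ ^ 2))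
      / Function.Periodic.qParam 1 (τ : ℂ)) atImInfty (𝓝 0))
    (hT3 : Tendsto (fun τ : ℍ ↦ etaQuotient 27 (expFn [(3, -1), (9, 4), (27, -3)]) τ ^ 3
      - etaQuotient 27 (expFn [(3, 3), (27, -3)]) τ ^ 2
      - 9 * etaQuotient 27 (expFn [(3, 3), (27, -3)]) τ - 27) atImInfty (𝓝 0))
    (W : WeierstrassCurve ℚ) [W.IsGloballyMinimal] (D : ModularParametrizationData W 27)
    (hopt : ∀ z ∈ D.L.lattice, ∃ w ∈ periodLattice D.f, z = D.c * w) :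
    |D.maninConstant| = 1 :=
  HexagonalSqueezeTwentySeven.abs_maninConstant_eq_one_twentySeven_of_periodLattice_le_hex
    (periodLatticeLeHex_of_tendsto hT1 hT2 hT3) W D hopt

end Summit.BirchSwinnertonDyer.BirchSwinnertonDyer.Theorems.ManinLocalTwoThree.EtaIdentityReduction

end
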